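import Literature.Probability.Percolation.InterfaceLoopClusters
import HarnessLib

/-!
# Interiors of two interface loops of one configuration are nested or disjoint (cells)

Crux `Summit.CriticalPhenomena.CardyFormulaZ2.Theses.CardyMagicRigidity.NestingRigidity`
(stmt-CriticalPhenomena-4835), line `markov-cascade-one-generation`, helper toward stub
`stub_oneGenerationZ2 : OneGenerationZ2` (S1, the one-generation factorisation on `ℤ²`).

For an interface loop `γ` of a bond configuration `ω` of `ℤ²` (`IsInterfaceLoop ω γ`) write
`W_γ = (loopCurve 1 0 γ).wind` and call a CELL (a lattice point `v`, drawn at `meshPoint 1 v`, or a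
face `f`, drawn at its centre `faceCenter f`) INTERIOR to `γ` when `W_γ ≠ 0` there.  Cells are the
vertices of a connected graph whose edges are the corners `(v, f)` (coded `p : Site 2 × Fin 4`,
`v = p.1`, `f = cFace p`); across the corner of a dart of `γ` the winding number jumps by `1`
(`IsInterfaceLoop.wind_sub_wind_cFace`) and exactly one of the two cells is interior
(`IsInterfaceLoop.wind_cells`), across every other corner it does not jump.

**Theorem** (`interfaceLoop_cells_nested_or_disjoint`, registered helper).  For two interface loops
`γ₁, γ₂` of the SAME configuration, the sets of interior cells are nested or disjoint.

Proof (no Jordan curve theorem).  If the loops share a dart they have the same dart set (the orbit of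
the successor map, `mem_zip_iff_exists_iterate`), hence the same jumps and the same cell windings.
Otherwise their dart sets are disjoint; walking along `γ₂` (consecutive darts share a cell) the
membership "both cells of the dart are interior to `γ₁`" is constant (`exists_dart_cells_iff`), and
symmetrically.  In each of the four cases a suitable Boolean combination of the two memberships is
preserved across every corner and vanishes far away; propagating it along the ray `v + ℕ e₀`
(`cells_empty_of_corner_iff`) empties it everywhere, which is the claimed inclusion / disjointness.
-/

noncomputable section

open Set Function

namespace Summit.CriticalPhenomena.CardyFormulaZ2.Cruxes.NestingRigidity.MarkovCascadeOneGeneration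

open Literature.Probability.RandomPlanarGeometry Literature.Probability.Percolation
  Literature.Probability.LatticeModels

variable {ω ω₁ ω₂ : BondConfig (Site 2)} {γ γ₁ γ₂ : List MedialVertex}

/-! ## Rays of cells to infinity -/

/-- The face of the corner `(v, 0)` is the face with lower-left corner `v`. -/
theorem cFace_vertex_zero (v : Site 2) : cFace (v, 0) = v := by
  simp [cFace, faceAt, cornerOff]

/-- The face of the corner `(v + e₀, 1)` is again the face with lower-left corner `v`. -/
theorem cFace_add_single_zero_one (v : Site 2) : cFace (v + Pi.single 0 1, 1) = v := by
  simp [cFace, faceAt, cornerOff]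

/-- **Ray propagation.** A property of cells that agrees across every corner and fails somewhere on
every eastward ray of lattice points `v + n e₀` fails at every cell. -/
theorem cells_empty_of_corner_iff {SV SF : Site 2 → Prop}
    (hc : ∀ p : Site 2 × Fin 4, SV p.1 ↔ SF (cFace p))
    (hfar : ∀ v : Site 2, ∃ n : ℕ, ¬ SV (v + Pi.single 0 (n : ℤ))) :
    (∀ v, ¬ SV v) ∧ ∀ f, ¬ SF f := by
  have hstep : ∀ v : Site 2, SV v ↔ SV (v + Pi.single 0 1) := fun v ↦ by
    rw [hc (v, 0), cFace_vertex_zero, hc (v + Pi.single 0 1, 1), cFace_add_single_zero_one]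
  have hV : ∀ v, ¬ SV v := by
    intro v hv
    have hall : ∀ n : ℕ, SV (v + Pi.single 0 (n : ℤ)) := by
      intro n
      induction n with
      | zero => simpa using hv
      | succ n ih =>
        rw [Nat.cast_succ, Pi.single_add, ← add_assoc]
        exact (hstep _).1 ih
    obtain ⟨n, hn⟩ := hfar v
    exact hn (hall n)
  exact ⟨hV, fun f hf ↦ hV f ((hc (f, 0)).2 (by rwa [cFace_vertex_zero]))⟩

/-- Far out on an eastward ray of lattice points the winding number of `loopCurve 1 0 γ` vanishes. -/
theorem exists_wind_ray_eq_zero (γ : List MedialVertex) (v : Site 2) :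
    ∃ N : ℕ, ∀ n : ℕ, N ≤ n →
      (loopCurve 1 0 γ).wind (meshPoint 1 (v + Pi.single 0 (n : ℤ))) = 0 := by
  obtain ⟨ρ, -, hfar, -⟩ := exists_radius_wind_ne_zero γ
  obtain ⟨N, hN⟩ := exists_nat_ge (ρ - v 0)
  refine ⟨N, fun n hn ↦ ?_⟩
  by_contra hne
  have h := hfar _ hne 0
  simp only [Pi.add_apply, Pi.single_eq_same, Int.cast_add, Int.cast_natCast] at h
  have hn' : (N : ℝ) ≤ n := by exact_mod_cast hn
  have := (le_abs_self ((v 0 : ℝ) + n)).trans_lt h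
  linarith

/-- Two loops at once: far out on an eastward ray both winding numbers vanish. -/
theorem exists_wind_ray_eq_zero₂ (γ₁ γ₂ : List MedialVertex) (v : Site 2) :
    ∃ n : ℕ, (loopCurve 1 0 γ₁).wind (meshPoint 1 (v + Pi.single 0 (n : ℤ))) = 0 ∧
      (loopCurve 1 0 γ₂).wind (meshPoint 1 (v + Pi.single 0 (n : ℤ))) = 0 := by
  obtain ⟨N₁, h₁⟩ := exists_wind_ray_eq_zero γ₁ v
  obtain ⟨N₂, h₂⟩ := exists_wind_ray_eq_zero γ₂ v
  exact ⟨max N₁ N₂, h₁ _ (le_max_left _ _), h₂ _ (le_max_right _ _)⟩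

/-! ## Jumps across corners -/

/-- Off the darts of the loop the winding number does not jump across a corner. -/
theorem wind_fst_eq_wind_cFace (h : IsInterfaceLoop ω γ) {p : Site 2 × Fin 4}
    (hp : (cSrc p, cTgt p) ∉ γ.zip (γ.rotate 1)) :
    (loopCurve 1 0 γ).wind (meshPoint 1 p.1) = (loopCurve 1 0 γ).wind (faceCenter (cFace p)) := by
  have := h.wind_sub_wind_cFace p
  rw [if_neg hp] at this
  omega

/-- Two interface loops of one configuration sharing a dart have the same darts. -/
theorem dart_iff_of_shared (h₁ : IsInterfaceLoop ω γ₁) (h₂ : IsInterfaceLoop ω γ₂)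
    {p : Site 2 × Fin 4} (hp₁ : (cSrc p, cTgt p) ∈ γ₁.zip (γ₁.rotate 1))
    (hp₂ : (cSrc p, cTgt p) ∈ γ₂.zip (γ₂.rotate 1)) (q : Site 2 × Fin 4) :
    (cSrc q, cTgt q) ∈ γ₁.zip (γ₁.rotate 1) ↔ (cSrc q, cTgt q) ∈ γ₂.zip (γ₂.rotate 1) := by
  rw [h₁.mem_zip_iff_exists_iterate hp₁ q, h₂.mem_zip_iff_exists_iterate hp₂ q]

/-- Interface loops with the same darts have the same cell winding numbers (same jumps, both
vanishing far away). -/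
theorem wind_cells_eq_of_dart_iff (h₁ : IsInterfaceLoop ω₁ γ₁) (h₂ : IsInterfaceLoop ω₂ γ₂)
    (hd : ∀ q : Site 2 × Fin 4,
      (cSrc q, cTgt q) ∈ γ₁.zip (γ₁.rotate 1) ↔ (cSrc q, cTgt q) ∈ γ₂.zip (γ₂.rotate 1)) :
    (∀ v : Site 2, (loopCurve 1 0 γ₁).wind (meshPoint 1 v) = (loopCurve 1 0 γ₂).wind (meshPoint 1 v)) ∧
      ∀ f : Site 2, (loopCurve 1 0 γ₁).wind (faceCenter f) = (loopCurve 1 0 γ₂).wind (faceCenter f) := by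
  have key := cells_empty_of_corner_iff
    (SV := fun v ↦ (loopCurve 1 0 γ₁).wind (meshPoint 1 v) ≠ (loopCurve 1 0 γ₂).wind (meshPoint 1 v))
    (SF := fun f ↦ (loopCurve 1 0 γ₁).wind (faceCenter f) ≠ (loopCurve 1 0 γ₂).wind (faceCenter f))
    ?_ ?_
  · exact ⟨fun v ↦ not_ne_iff.1 (key.1 v), fun f ↦ not_ne_iff.1 (key.2 f)⟩
  · intro p
    have j₁ := h₁.wind_sub_wind_cFace p
    have j₂ := h₂.wind_sub_wind_cFace p
    by_cases hq : (cSrc p, cTgt p) ∈ γ₁.zip (γ₁.rotate 1)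
    · rw [if_pos hq] at j₁
      rw [if_pos ((hd p).1 hq)] at j₂
      simp only [ne_eq]
      omega
    · rw [if_neg hq] at j₁
      rw [if_neg fun h ↦ hq ((hd p).2 h)] at j₂
      simp only [ne_eq]
      omega
  · intro v
    obtain ⟨n, hn₁, hn₂⟩ := exists_wind_ray_eq_zero₂ γ₁ γ₂ v
    exact ⟨n, fun h ↦ h (hn₁.trans hn₂.symm)⟩

/-- **Walking along a loop.** If the darts of `γ₂` avoid those of `γ₁`, then either every dart of
`γ₂` has both its cells interior to `γ₁`, or none has any: the membership is one Boolean `b`. -/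
theorem exists_dart_cells_iff (h₁ : IsInterfaceLoop ω γ₁) (h₂ : IsInterfaceLoop ω γ₂)
    (hdis : ∀ q : Site 2 × Fin 4,
      (cSrc q, cTgt q) ∈ γ₂.zip (γ₂.rotate 1) → (cSrc q, cTgt q) ∉ γ₁.zip (γ₁.rotate 1)) :
    ∃ b : Prop, ∀ p : Site 2 × Fin 4, (cSrc p, cTgt p) ∈ γ₂.zip (γ₂.rotate 1) →
      ((loopCurve 1 0 γ₁).wind (meshPoint 1 p.1) ≠ 0 ↔ b) ∧
        ((loopCurve 1 0 γ₁).wind (faceCenter (cFace p)) ≠ 0 ↔ b) := by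
  obtain ⟨p₀, hs, ht⟩ := h₂.exists_corner 0
  have hp₀ : (cSrc p₀, cTgt p₀) ∈ γ₂.zip (γ₂.rotate 1) := by
    rw [hs, ht]
    exact h₂.getElem_mod_mem_zip 0
  refine ⟨(loopCurve 1 0 γ₁).wind (meshPoint 1 p₀.1) ≠ 0, fun p hp ↦ ?_⟩
  obtain ⟨m, rfl⟩ := h₂.exists_eq_iterate hp₀ hp
  clear hp
  induction m with
  | zero =>
    refine ⟨Iff.rfl, ?_⟩
    rw [Function.iterate_zero, id_eq, ← wind_fst_eq_wind_cFace h₁ (hdis _ hp₀)]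
  | succ m ih =>
    have hm1 : (cSrc ((nextCorner ω)^[m + 1] p₀), cTgt ((nextCorner ω)^[m + 1] p₀)) ∈
        γ₂.zip (γ₂.rotate 1) := (h₂.mem_zip_iterate_iff p₀ (m + 1)).2 hp₀
    rw [Function.iterate_succ_apply'] at hm1 ⊢
    obtain ⟨ihv, ihf⟩ := ih
    have hC := wind_fst_eq_wind_cFace h₁ (hdis _ hm1)
    by_cases ho : cTgt ((nextCorner ω)^[m] p₀) ∈ ω
    · have hf : cFace (nextCorner ω ((nextCorner ω)^[m] p₀)) = cFace ((nextCorner ω)^[m] p₀) :=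
        cFace_nextCorner_of_mem ho
      refine ⟨?_, by rw [hf]; exact ihf⟩
      rw [hC, hf]
      exact ihf
    · have hv : (nextCorner ω ((nextCorner ω)^[m] p₀)).1 = ((nextCorner ω)^[m] p₀).1 := by
        rw [nextCorner_of_not_mem ho]
      refine ⟨by rw [hv]; exact ihv, ?_⟩
      rw [← hC, hv]
      exact ihv

/-! ## The cell trichotomy -/

/-- **Interior cells of two interface loops of one configuration are nested or disjoint**
(registered helper `interfaceLoop_cells_nested_or_disjoint` toward `stub_oneGenerationZ2`). -/
theorem interfaceLoop_cells_nested_or_disjoint : ∀ (ω : BondConfig (Site 2))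
    (γ₁ γ₂ : List MedialVertex), IsInterfaceLoop ω γ₁ → IsInterfaceLoop ω γ₂ →
    ((∀ v : Site 2, (loopCurve 1 0 γ₁).wind (meshPoint 1 v) ≠ 0 →
        (loopCurve 1 0 γ₂).wind (meshPoint 1 v) ≠ 0) ∧
      ∀ f : Site 2, (loopCurve 1 0 γ₁).wind (faceCenter f) ≠ 0 →
        (loopCurve 1 0 γ₂).wind (faceCenter f) ≠ 0) ∨
    ((∀ v : Site 2, (loopCurve 1 0 γ₂).wind (meshPoint 1 v) ≠ 0 →
        (loopCurve 1 0 γ₁).wind (meshPoint 1 v) ≠ 0) ∧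
      ∀ f : Site 2, (loopCurve 1 0 γ₂).wind (faceCenter f) ≠ 0 →
        (loopCurve 1 0 γ₁).wind (faceCenter f) ≠ 0) ∨
    ((∀ v : Site 2, (loopCurve 1 0 γ₁).wind (meshPoint 1 v) ≠ 0 →
        (loopCurve 1 0 γ₂).wind (meshPoint 1 v) = 0) ∧
      ∀ f : Site 2, (loopCurve 1 0 γ₁).wind (faceCenter f) ≠ 0 →
        (loopCurve 1 0 γ₂).wind (faceCenter f) = 0) := by
  intro ω γ₁ γ₂ h₁ h₂
  by_cases hshare : ∃ q : Site 2 × Fin 4,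
      (cSrc q, cTgt q) ∈ γ₁.zip (γ₁.rotate 1) ∧ (cSrc q, cTgt q) ∈ γ₂.zip (γ₂.rotate 1)
  · -- shared dart: identical cell windings
    obtain ⟨q, hq₁, hq₂⟩ := hshare
    obtain ⟨hV, hF⟩ := wind_cells_eq_of_dart_iff h₁ h₂ (dart_iff_of_shared h₁ h₂ hq₁ hq₂)
    exact Or.inl ⟨fun v hv ↦ by rwa [← hV v], fun f hf ↦ by rwa [← hF f]⟩
  push Not at hshare
  obtain ⟨b₁, hb₁⟩ := exists_dart_cells_iff h₁ h₂ fun q hq hq' ↦ hshare q hq' hq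
  obtain ⟨b₂, hb₂⟩ := exists_dart_cells_iff h₂ h₁ hshare
  -- off both loops' darts nothing jumps
  have hoff : ∀ p : Site 2 × Fin 4, (cSrc p, cTgt p) ∉ γ₁.zip (γ₁.rotate 1) →
      (cSrc p, cTgt p) ∉ γ₂.zip (γ₂.rotate 1) →
      (loopCurve 1 0 γ₁).wind (meshPoint 1 p.1) = (loopCurve 1 0 γ₁).wind (faceCenter (cFace p)) ∧
      (loopCurve 1 0 γ₂).wind (meshPoint 1 p.1) = (loopCurve 1 0 γ₂).wind (faceCenter (cFace p)) :=
    fun p d₁ d₂ ↦ ⟨wind_fst_eq_wind_cFace h₁ d₁, wind_fst_eq_wind_cFace h₂ d₂⟩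
  by_cases hB₁ : b₁ <;> by_cases hB₂ : b₂
  · -- each loop inside the other: impossible unless both interiors are empty
    left
    have key := cells_empty_of_corner_iff
      (SV := fun v ↦ (loopCurve 1 0 γ₁).wind (meshPoint 1 v) ≠ 0 ∨
        (loopCurve 1 0 γ₂).wind (meshPoint 1 v) ≠ 0)
      (SF := fun f ↦ (loopCurve 1 0 γ₁).wind (faceCenter f) ≠ 0 ∨
        (loopCurve 1 0 γ₂).wind (faceCenter f) ≠ 0) ?_ ?_
    · exact ⟨fun v hv ↦ absurd (Or.inl hv) (key.1 v), fun f hf ↦ absurd (Or.inl hf) (key.2 f)⟩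
    · intro p
      by_cases d₁ : (cSrc p, cTgt p) ∈ γ₁.zip (γ₁.rotate 1)
      · obtain ⟨hv, hf⟩ := hb₂ p d₁
        exact iff_of_true (Or.inr (hv.2 hB₂)) (Or.inr (hf.2 hB₂))
      by_cases d₂ : (cSrc p, cTgt p) ∈ γ₂.zip (γ₂.rotate 1)
      · obtain ⟨hv, hf⟩ := hb₁ p d₂
        exact iff_of_true (Or.inl (hv.2 hB₁)) (Or.inl (hf.2 hB₁))
      obtain ⟨e₁, e₂⟩ := hoff p d₁ d₂
      simp only [e₁, e₂]
    · intro v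
      obtain ⟨n, hn₁, hn₂⟩ := exists_wind_ray_eq_zero₂ γ₁ γ₂ v
      exact ⟨n, fun h ↦ h.elim (fun h' ↦ h' hn₁) fun h' ↦ h' hn₂⟩
  · -- `γ₂` inside `γ₁`
    right; left
    have key := cells_empty_of_corner_iff
      (SV := fun v ↦ (loopCurve 1 0 γ₂).wind (meshPoint 1 v) ≠ 0 ∧
        (loopCurve 1 0 γ₁).wind (meshPoint 1 v) = 0)
      (SF := fun f ↦ (loopCurve 1 0 γ₂).wind (faceCenter f) ≠ 0 ∧
        (loopCurve 1 0 γ₁).wind (faceCenter f) = 0) ?_ ?_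
    · exact ⟨fun v hv ↦ fun h0 ↦ key.1 v ⟨hv, h0⟩, fun f hf ↦ fun h0 ↦ key.2 f ⟨hf, h0⟩⟩
    · intro p
      by_cases d₁ : (cSrc p, cTgt p) ∈ γ₁.zip (γ₁.rotate 1)
      · obtain ⟨hv, hf⟩ := hb₂ p d₁
        exact iff_of_false (fun h ↦ hB₂ (hv.1 h.1)) fun h ↦ hB₂ (hf.1 h.1)
      by_cases d₂ : (cSrc p, cTgt p) ∈ γ₂.zip (γ₂.rotate 1)
      · obtain ⟨hv, hf⟩ := hb₁ p d₂
        exact iff_of_false (fun h ↦ hv.2 hB₁ h.2) fun h ↦ hf.2 hB₁ h.2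
      obtain ⟨e₁, e₂⟩ := hoff p d₁ d₂
      simp only [e₁, e₂]
    · intro v
      obtain ⟨n, -, hn₂⟩ := exists_wind_ray_eq_zero₂ γ₁ γ₂ v
      exact ⟨n, fun h ↦ h.1 hn₂⟩
  · -- `γ₁` inside `γ₂`
    left
    have key := cells_empty_of_corner_iff
      (SV := fun v ↦ (loopCurve 1 0 γ₁).wind (meshPoint 1 v) ≠ 0 ∧
        (loopCurve 1 0 γ₂).wind (meshPoint 1 v) = 0)
      (SF := fun f ↦ (loopCurve 1 0 γ₁).wind (faceCenter f) ≠ 0 ∧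
        (loopCurve 1 0 γ₂).wind (faceCenter f) = 0) ?_ ?_
    · exact ⟨fun v hv ↦ fun h0 ↦ key.1 v ⟨hv, h0⟩, fun f hf ↦ fun h0 ↦ key.2 f ⟨hf, h0⟩⟩
    · intro p
      by_cases d₁ : (cSrc p, cTgt p) ∈ γ₁.zip (γ₁.rotate 1)
      · obtain ⟨hv, hf⟩ := hb₂ p d₁
        exact iff_of_false (fun h ↦ hv.2 hB₂ h.2) fun h ↦ hf.2 hB₂ h.2
      by_cases d₂ : (cSrc p, cTgt p) ∈ γ₂.zip (γ₂.rotate 1)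
      · obtain ⟨hv, hf⟩ := hb₁ p d₂
        exact iff_of_false (fun h ↦ hB₁ (hv.1 h.1)) fun h ↦ hB₁ (hf.1 h.1)
      obtain ⟨e₁, e₂⟩ := hoff p d₁ d₂
      simp only [e₁, e₂]
    · intro v
      obtain ⟨n, hn₁, -⟩ := exists_wind_ray_eq_zero₂ γ₁ γ₂ v
      exact ⟨n, fun h ↦ h.1 hn₁⟩
  · -- disjoint interiors
    right; right
    have key := cells_empty_of_corner_iff
      (SV := fun v ↦ (loopCurve 1 0 γ₁).wind (meshPoint 1 v) ≠ 0 ∧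
        (loopCurve 1 0 γ₂).wind (meshPoint 1 v) ≠ 0)
      (SF := fun f ↦ (loopCurve 1 0 γ₁).wind (faceCenter f) ≠ 0 ∧
        (loopCurve 1 0 γ₂).wind (faceCenter f) ≠ 0) ?_ ?_
    · exact ⟨fun v hv ↦ not_ne_iff.1 fun h0 ↦ key.1 v ⟨hv, h0⟩,
        fun f hf ↦ not_ne_iff.1 fun h0 ↦ key.2 f ⟨hf, h0⟩⟩
    · intro p
      by_cases d₁ : (cSrc p, cTgt p) ∈ γ₁.zip (γ₁.rotate 1)
      · obtain ⟨hv, hf⟩ := hb₂ p d₁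
        exact iff_of_false (fun h ↦ hB₂ (hv.1 h.2)) fun h ↦ hB₂ (hf.1 h.2)
      by_cases d₂ : (cSrc p, cTgt p) ∈ γ₂.zip (γ₂.rotate 1)
      · obtain ⟨hv, hf⟩ := hb₁ p d₂
        exact iff_of_false (fun h ↦ hB₁ (hv.1 h.1)) fun h ↦ hB₁ (hf.1 h.1)
      obtain ⟨e₁, e₂⟩ := hoff p d₁ d₂
      simp only [e₁, e₂]
    · intro v
      obtain ⟨n, hn₁, -⟩ := exists_wind_ray_eq_zero₂ γ₁ γ₂ v
      exact ⟨n, fun h ↦ h.1 hn₁⟩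

end Summit.CriticalPhenomena.CardyFormulaZ2.Cruxes.NestingRigidity.MarkovCascadeOneGeneration

end
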